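import Literature.IUT.HodgeArakelov.FlSymmetryConjActionSections
import Literature.AnabelianGeometry.EtaleTheta.Discharge.Sec1DeltaThetaZHat
import Literature.IUT.HodgeTheaters.ZHatEndomorphisms
import Literature.AnabelianGeometry.EtaleTheta.Discharge.Sec1CompatOfSetting
import HarnessLib

/-!
# [IUTchII] Rmk. 1.1.1 (iv) / [EtTh] §1–§2: the commutator pairing `θ(x b x⁻¹ b⁻¹)` DESCENDS to
# `(Δ^tp_X/Δ^tp_Y) × (Δ^tp_Y)^ell`, and `(Δ^tp_{Y̲̲})^ell = (Δ^tp_Y)^ell` (lemmas (i), (ii) of GAP row G-w4d018-1)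

Mochizuki, *Inter-universal Teichmüller theory II*, §1, Remark 1.1.1 (iii)–(iv), kurims manuscript (Dec. 2020) pp. 22–24
[claim: Mochizuki2012, status: disputed] (IUTchII §1 Rmk 1.1.1 (iv), kurims p.23): «one obtains a natural bilinear
commutator map `[-,-] : (Δ_X(M^Θ)/Δ_Y(M^Θ)) × Δ^ell_Y(M^Θ) → Π_{M^Θ}|_{(l·Δ_Θ)(M^Θ)}` … for which both the domain and
the codomain are equipped with natural actions by `Π_C(M^Θ)`. Now one verifies easily that this commutator map is
equivariant»; [EtTh] §1 p. 12 («`1 → Δ_Θ → (Δ^tp_Y)^Θ → (Δ^tp_Y)^ell → 1`», «`Δ_Θ (≅ Ẑ(1))`»), Def. 2.5 (i) p. 39,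
Def. 2.7 p. 41 («`Y̲̲^log → Y^log` … of degree `l`»), Prop. 2.12 (i) p. 45 («`l·Δ_Θ`») [cite: MochizukiEtTh2009, Def 2.7 p.41].

abc-iut cell, layer L6, seat abc-iut-w4-d035 (gen 11), GAP-LEDGER row **G-w4d018-1** (commutator-equivariance
sub-clause of [IUTchII] Rmk. 1.1.1 (iv) at the genuine frame; node IUTchII:Rmk1.1.1(iv) (iv)-C), its missing lemmas
(i) and (ii). PROOF-ONLY (0 `def`/`structure`/`instance`); pure group theory over abc-iut-L2-t1's [EtTh] §1 theta setting
`D : ThetaSetting p` and abc-iut-L2-t8's choice `C : E.DoubleUnderline l` of `X̲̲` (dot-notation extensions declared by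
absolute name from the L6 directory, precedent `CoreTowerFlPMQuotient.lean`):

* **`ThetaSetting.toTheta_conjComm_eq_of_toZ_eq_of_thetaToEll_eq`** (lemma (ii), the PAIRING LEMMA): for `x, x'`
  geometric (`aug = 1`) with the SAME image in `Z = Π^tp_X/Π^tp_Y` and `b, b' ∈ Δ^tp_Y` with the SAME image in
  `(Π^tp_X)^ell`, `θ(x b x⁻¹ b⁻¹) = θ(x' b' x'⁻¹ b'⁻¹)` — `x⁻¹x' ∈ Δ^tp_Y` and `(Δ^tp_Y)^Θ` is ABELIAN (abc-iut-L2-t8's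
  theorem `dtpYTheta_comm`, input `IsEtThOrigin`), `θ(b)⁻¹θ(b') ∈ Δ_Θ` is CENTRAL in `(Δ^tp_X)^Θ` (root field
  `ker_thetaToEll_central`); i.e. `[-,-]` is a function of `(toZ x, toEll b)` — the lifts in abc-iut-w5-d225's
  construction (p437698, (T1)/(T2)) may be taken ANYWHERE in `Δ^tp_X`, `Δ^tp_Y`, not only in `Π^tp_{X̲̲}`;
* **`ThetaSetting.EtaleThetaData.DoubleUnderline.exists_mem_Huu_dtpY_thetaToEll_eq`** (lemma (i),
  «`(Δ^tp_{Y̲̲})^ell = (Δ^tp_Y)^ell`»): every `b ∈ Δ^tp_Y` has the same image in `(Π^tp_X)^ell` as some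
  `b' ∈ Δ^tp_{Y̲̲} = Π^tp_{X̲̲} ∩ Δ^tp_Y`. Proof (index `l`, `l` prime): `Δ_Θ ≅ Ẑ` (abc-iut-L2 `Sec1DeltaThetaZHat`,
  inputs `IsEtThOrigin` + `hYcl`) is not `l`-divisible (`l ≥ 2`: the component at the index-`l` quotient of `Ẑ`), so
  some `s ∈ Δ^tp_Y` has `θ(s) ∈ Δ_Θ ∖ l·Δ_Θ` (`deltaTheta_le_DtpYTheta`), hence `s ∉ Π^tp_{X̲̲}`
  (`map_toTheta_Huu : θ(Π^tp_{X̲̲}) ∩ Δ_Θ = l·Δ_Θ`) while `s^l ∈ Π^tp_{X̲̲}` (same field + the binder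
  `hker : Ker θ ≤ Π^tp_{X̲̲}` of abc-iut-w5-d165); as `[Π^tp_Y : Π^tp_Y ∩ Π^tp_{X̲̲}] = l` (`relIndex_Huu_GtpY`) is prime,
  the cosets `s^i·(Π^tp_Y ∩ Π^tp_{X̲̲})`, `0 ≤ i < l`, exhaust `Π^tp_Y`, and `b' := s^{-i} b` works since `θ(s) ∈ Δ_Θ =
  Ker((Π^tp_X)^Θ ↠ (Π^tp_X)^ell)`.
Needed because `Π^tp_{X̲̲}` is NOT normal in `Π^tp_C` (abc-iut-L2 `SettingModel.not_normal_Huuχ`): conjugation by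
`Π_C(M)` leaves `Δ_X(M) = Δ^tp_{X̲̲}`, `Δ_Y(M) = Δ^tp_{Y̲̲}`, and the actions on `Δ_X(M)/Δ_Y(M)`, `Δ^ell_Y(M)` are read
back through `toZ` and `(Π^tp_X)^ell` (sequel files). BINDER CENSUS (BY NAME): `IsEtThOrigin`, `hYcl`, `hker`, `l` prime;
no `Prop` fact introduced, no FACT-LIST row consumed. HONEST FRAMING: kernel facts about the cell's own typed interfaces;
[EtTh] refereed, typed not endorsed; Rmk. 1.1.1 is outside the [IUTchIII] Cor. 3.12 cone; no side taken on Cor. 3.12;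
typed ≠ proved.
-/

noncomputable section

namespace Literature.IUT.HodgeArakelov

open Literature.AnabelianGeometry.EtaleTheta Literature.AnabelianGeometry.SemiGraphs
open scoped Literature.AnabelianGeometry.EtaleTheta

variable {p : ℕ} [Fact p.Prime]

/-! ## Lemma (ii): the pairing `θ(x b x⁻¹ b⁻¹)` depends only on `(toZ x, toEll b)` -/

/-- **The commutator pairing descends** ([IUTchII] Rmk. 1.1.1 (iii)–(iv) «a natural bilinear commutator map
`[-,-] : (Δ_X/Δ_Y) × Δ^ell_Y → Π_M|_{(l·Δ_Θ)}`»): for geometric `x, x' ∈ Δ^tp_X` with `toZ x = toZ x'` and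
`b ∈ Δ^tp_Y`, `b'` with the same image in `(Π^tp_X)^ell`, `θ(x b x⁻¹ b⁻¹) = θ(x' b' x'⁻¹ b'⁻¹)` in `(Π^tp_X)^Θ` —
`(Δ^tp_Y)^Θ` is abelian (`dtpYTheta_comm`, input `IsEtThOrigin`) and `Δ_Θ` is central in `(Δ^tp_X)^Θ`.
[cite: MochizukiEtTh2009, §1 p.12] -/
theorem _root_.Literature.AnabelianGeometry.EtaleTheta.ThetaSetting.toTheta_conjComm_eq_of_toZ_eq_of_thetaToEll_eq
    (D : Literature.AnabelianGeometry.EtaleTheta.ThetaSetting p) (hO : D.IsEtThOrigin) {x x' b b' : D.PiTemp}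
    (hx : D.aug x = 1) (hx' : D.aug x' = 1) (hxx' : D.toZ x = D.toZ x')
    (hb : b ∈ D.DtpY)
    (hbb' : D.thetaToEll (D.toTheta b) = D.thetaToEll (D.toTheta b')) :
    D.toTheta (x * b * x⁻¹ * b⁻¹) = D.toTheta (x' * b' * x'⁻¹ * b'⁻¹) := by
  have hYab := D.dtpYTheta_comm hO
  -- (T1) replace `x` by `x' = x · (x⁻¹ x')`, `x⁻¹ x' ∈ Δ^tp_Y`
  have hδY : x⁻¹ * x' ∈ D.GtpY := by
    change x⁻¹ * x' ∈ D.toZ.ker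
    rw [MonoidHom.mem_ker, map_mul, map_inv, hxx', inv_mul_cancel]
  have hδaug : D.aug (x⁻¹ * x') = 1 := by rw [map_mul, map_inv, hx, hx', inv_one, one_mul]
  have hδΘ : D.toTheta (x⁻¹ * x') ∈ D.DtpYTheta := Subgroup.mem_map_of_mem _ ⟨hδY, hδaug⟩
  have hbΘ : D.toTheta b ∈ D.DtpYTheta := Subgroup.mem_map_of_mem _ hb
  have h1 : D.toTheta (x' * b * x'⁻¹ * b⁻¹) = D.toTheta (x * b * x⁻¹ * b⁻¹) := by
    have hx'eq : x' = x * (x⁻¹ * x') := by rw [mul_inv_cancel_left]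
    have key := conjComm_central_mul_left (D.toTheta x) (D.toTheta (x⁻¹ * x')) (D.toTheta b)
      (hYab _ hδΘ _ hbΘ)
    rw [← map_mul, ← hx'eq] at key
    simpa only [map_mul, map_inv] using key
  -- (T2) replace `b` by `b' = b · (b⁻¹ b')`, `θ(b⁻¹ b') ∈ Δ_Θ` central
  have hc : D.toTheta (b⁻¹ * b') ∈ D.DeltaTheta := by
    change D.toTheta (b⁻¹ * b') ∈ D.thetaToEll.ker
    rw [MonoidHom.mem_ker, map_mul, map_inv, map_mul, map_inv, hbb', inv_mul_cancel]
  have hx'Δ : (D.toTheta x')⁻¹ ∈ (D.aug.toMonoidHom.ker).map D.toTheta := by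
    rw [← map_inv]
    exact Subgroup.mem_map_of_mem _ (by
      rw [MonoidHom.mem_ker, map_inv]
      change (D.aug x')⁻¹ = 1
      rw [hx', inv_one])
  have h2 : D.toTheta (x' * b' * x'⁻¹ * b'⁻¹) = D.toTheta (x' * b * x'⁻¹ * b⁻¹) := by
    have hb'eq : b' = b * (b⁻¹ * b') := by rw [mul_inv_cancel_left]
    rw [hb'eq]
    simp only [map_mul, map_inv]
    have hcg := D.ker_thetaToEll_central _ hc _ hx'Δ
    rw [map_mul, map_inv] at hcg
    exact conjComm_mul_central_right _ _ _ hcg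
  rw [h2, h1]

/-! ## Lemma (i): `(Δ^tp_{Y̲̲})^ell = (Δ^tp_Y)^ell` -/

namespace CommutatorPairingDescent

/-- **`Ẑ` is not `l`-divisible** (`l ≥ 2`): the element `η(1) ∈ Ẑ` is not an `l`-th power — its component at the
index-`l` quotient `ℤ/l` is the class of `1`, while an `l`-th power has trivial component there.
[cite: MochizukiEtTh2009, §1 p.12] -/
theorem zHat_exists_not_pow {l : ℕ} (hl : 2 ≤ l) :
    ∃ z : Literature.IUT.HodgeTheaters.ZHat, ∀ y : Literature.IUT.HodgeTheaters.ZHat, y ^ l ≠ z := by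
  obtain ⟨N, hN⟩ := Literature.IUT.HodgeTheaters.ZHat.exists_index_eq l (by omega)
  -- the `N`-th component, a surjection onto `ℤ/l`
  let π : Literature.IUT.HodgeTheaters.ZHat →* Multiplicative ℤ ⧸ N.toSubgroup :=
    MonoidHom.mk' (fun w => w.val N) (fun w w' => ProfiniteGrp.limit_mul_val _ w w' N)
  have hπsurj : Function.Surjective π := Literature.IUT.HodgeTheaters.ProfiniteCompletion.val_surjective N
  have hidx : π.ker.index = l := by
    rw [Subgroup.index_ker, MonoidHom.range_eq_top.mpr hπsurj, Subgroup.card_top]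
    exact hN
  haveI : π.ker.FiniteIndex := ⟨by rw [hidx]; omega⟩
  refine ⟨Literature.IUT.HodgeTheaters.toCompletion _ (Multiplicative.ofAdd (1 : ℤ)), fun y hy => ?_⟩
  -- an `l`-th power has trivial `N`-component, `η(1)` has component the class of `1`
  have hmem := Subgroup.pow_index_mem π.ker y
  rw [hidx, hy, MonoidHom.mem_ker] at hmem
  have h1 : (QuotientGroup.mk (Multiplicative.ofAdd (1 : ℤ)) : Multiplicative ℤ ⧸ N.toSubgroup) = 1 := hmem
  rw [QuotientGroup.eq_one_iff, Literature.IUT.HodgeTheaters.ZHat.ofAdd_mem_iff_index_dvd, hN] at h1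
  have : (l : ℤ) ≤ 1 := Int.le_of_dvd one_pos h1
  omega

end CommutatorPairingDescent

open CommutatorPairingDescent in
/-- **`Δ_Θ` has an element outside `l·Δ_Θ`** (`l ≥ 2`): `Δ_Θ ≅ Ẑ` as an abstract group (abc-iut-L2
`IsEtThOrigin.nonempty_deltaTheta_mulEquiv_zHat`, inputs `IsEtThOrigin` + `hYcl`) and `Ẑ` is not `l`-divisible.
[cite: MochizukiEtTh2009, §1 p.12] -/
theorem _root_.Literature.AnabelianGeometry.EtaleTheta.ThetaSetting.IsEtThOrigin.exists_mem_deltaTheta_not_mem_lDeltaTheta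
    {D : Literature.AnabelianGeometry.EtaleTheta.ThetaSetting p} (hO : D.IsEtThOrigin)
    (hYcl : (D.DtpY.map D.toHat.toMonoidHom).topologicalClosure ≤
      D.DtpY.map D.toHat.toMonoidHom ⊔ (⁅⁅D.DeltaHat, D.DeltaHat⁆, D.DeltaHat⁆).topologicalClosure)
    {l : ℕ} (hl : 2 ≤ l) : ∃ t ∈ D.DeltaTheta, t ∉ D.lDeltaTheta l := by
  obtain ⟨φ⟩ := hO.nonempty_deltaTheta_mulEquiv_zHat hYcl
  obtain ⟨z, hz⟩ := zHat_exists_not_pow hl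
  refine ⟨(φ.symm z : ↥D.DeltaTheta), (φ.symm z).2, ?_⟩
  rintro ⟨y, hy, hyz⟩
  apply hz (φ ⟨y, hy⟩)
  have h : (⟨y, hy⟩ : ↥D.DeltaTheta) ^ l = φ.symm z := Subtype.ext hyz
  rw [← map_pow, h, MulEquiv.apply_symm_apply]

/-- **`(Δ^tp_{Y̲̲})^ell = (Δ^tp_Y)^ell`** ([EtTh] Def. 2.7 p. 41 «`Y̲̲^log → Y^log` … of degree `l`»; [IUTchII] Rmk. 1.1.1
(i) «`Δ^ell_Y(M^Θ)`», the SAME rank-one quotient for `Y̲̲` and `Y`): every `b ∈ Δ^tp_Y` has the same image in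
`(Π^tp_X)^ell` as some `b' ∈ Δ^tp_{Y̲̲} = Π^tp_{X̲̲} ∩ Δ^tp_Y`. Index argument with `l` prime: an `s ∈ Δ^tp_Y` with
`θ(s) ∈ Δ_Θ ∖ l·Δ_Θ` lies outside `Π^tp_{X̲̲}` (`map_toTheta_Huu`) but `s^l ∈ Π^tp_{X̲̲}` (same field + `hker`), so the
cosets `s^i (Π^tp_Y ∩ Π^tp_{X̲̲})`, `i < l`, exhaust `Π^tp_Y` (`relIndex_Huu_GtpY = l`), and `θ(s) ∈ Δ_Θ` dies in
`(Π^tp_X)^ell`. Inputs BY NAME: `IsEtThOrigin`, `hYcl`, `hker`, `l` prime. [cite: MochizukiEtTh2009, Def 2.7 p.41] -/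
theorem _root_.Literature.AnabelianGeometry.EtaleTheta.ThetaSetting.EtaleThetaData.DoubleUnderline.exists_mem_Huu_dtpY_thetaToEll_eq
    {D : Literature.AnabelianGeometry.EtaleTheta.ThetaSetting p} {E : D.EtaleThetaData} {l : ℕ} (C : E.DoubleUnderline l) (hO : D.IsEtThOrigin)
    (hYcl : (D.DtpY.map D.toHat.toMonoidHom).topologicalClosure ≤
      D.DtpY.map D.toHat.toMonoidHom ⊔ (⁅⁅D.DeltaHat, D.DeltaHat⁆, D.DeltaHat⁆).topologicalClosure)
    (hker : D.toTheta.ker ≤ C.Huu) (hl : l.Prime) {b : D.PiTemp} (hb : b ∈ D.DtpY) :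
    ∃ b' ∈ C.Huu ⊓ D.DtpY, D.thetaToEll (D.toTheta b') = D.thetaToEll (D.toTheta b) := by
  classical
  -- ### an `s ∈ Δ^tp_Y` with `θ(s) ∈ Δ_Θ ∖ l·Δ_Θ`
  obtain ⟨t, htΘ, htl⟩ := hO.exists_mem_deltaTheta_not_mem_lDeltaTheta hYcl hl.two_le
  obtain ⟨s, hsY, hst⟩ := (D.deltaTheta_le_DtpYTheta htΘ : t ∈ D.DtpYTheta)
  have hsG : s ∈ D.GtpY := hsY.1
  have hs_not : s ∉ C.Huu := by
    intro hs
    apply htl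
    rw [← C.map_toTheta_Huu]
    exact ⟨⟨s, hs, hst⟩, hst ▸ htΘ⟩
  -- `s^l ∈ Π^tp_{X̲̲}` : `θ(s)^l ∈ l·Δ_Θ = θ(Π^tp_{X̲̲}) ∩ Δ_Θ`, and `Ker θ ≤ Π^tp_{X̲̲}`
  have hsl : s ^ l ∈ C.Huu := by
    have hmem : D.toTheta (s ^ l) ∈ C.Huu.map D.toTheta ⊓ D.DeltaTheta := by
      rw [C.map_toTheta_Huu, map_pow, hst]
      exact ⟨t, htΘ, rfl⟩
    obtain ⟨⟨h, hh, hθ⟩, -⟩ := hmem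
    have hk : h⁻¹ * s ^ l ∈ D.toTheta.ker := by
      rw [MonoidHom.mem_ker, map_mul, map_inv, hθ, inv_mul_cancel]
    have := C.Huu.mul_mem hh (hker hk)
    rwa [mul_inv_cancel_left] at this
  -- ### the cosets `s^i · (Π^tp_Y ∩ Π^tp_{X̲̲})`, `i < l`, exhaust `Π^tp_Y`
  set H : Subgroup ↥D.GtpY := (C.Huu ⊓ D.GtpY).subgroupOf D.GtpY with hH
  have hidx : H.index = l := C.relIndex_Huu_GtpY
  haveI : H.FiniteIndex := ⟨by rw [hidx]; exact hl.ne_zero⟩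
  let s' : ↥D.GtpY := ⟨s, hsG⟩
  have hs'l : s' ^ l ∈ H := by
    rw [hH, Subgroup.mem_subgroupOf, SubgroupClass.coe_pow]
    exact ⟨hsl, (D.GtpY.pow_mem hsG l)⟩
  have hs'zpow : ∀ k : ℤ, s' ^ ((l : ℤ) * k) ∈ H := fun k => by
    rw [zpow_mul, zpow_natCast]; exact H.zpow_mem hs'l k
  -- `s'^d ∈ H` forces `l ∣ d` (Bezout: otherwise `s' ∈ H`, i.e. `s ∈ Π^tp_{X̲̲}`)
  have hdvd : ∀ d : ℤ, s' ^ d ∈ H → (l : ℤ) ∣ d := by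
    intro d hd
    by_contra hnd
    have hg1 : Int.gcd (l : ℤ) d = 1 := by
      rcases Nat.Prime.eq_one_or_self_of_dvd hl (Int.gcd (l : ℤ) d)
          (Int.natCast_dvd_natCast.mp (Int.gcd_dvd_left (a := (l : ℤ)) (b := d))) with h | h
      · exact h
      · have h2 := Int.gcd_dvd_right (a := (l : ℤ)) (b := d)
        rw [h] at h2
        exact absurd h2 hnd
    obtain ⟨u, v, huv⟩ := Int.isCoprime_iff_gcd_eq_one.mpr hg1
    apply hs_not
    have hmem : s' ^ (u * (l : ℤ) + v * d) ∈ H := by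
      rw [zpow_add, mul_comm u, zpow_mul, zpow_natCast, mul_comm v, zpow_mul]
      exact H.mul_mem (H.zpow_mem hs'l u) (H.zpow_mem hd v)
    rw [huv, zpow_one, hH, Subgroup.mem_subgroupOf] at hmem
    exact hmem.1
  haveI : NeZero l := ⟨hl.ne_zero⟩
  let f : ZMod l → ↥D.GtpY ⧸ H := fun i => QuotientGroup.mk (s' ^ i.val)
  have hf : Function.Injective f := by
    intro i j hij
    have h := QuotientGroup.eq.1 hij
    rw [← zpow_natCast, ← zpow_natCast, ← zpow_neg, ← zpow_add] at h
    obtain ⟨k, hk⟩ := hdvd _ h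
    have hi := i.val_lt
    have hj := j.val_lt
    have hk0 : k = 0 := by
      rcases lt_trichotomy k 0 with hk0 | hk0 | hk0
      · nlinarith
      · exact hk0
      · nlinarith
    rw [hk0, mul_zero] at hk
    apply ZMod.val_injective
    omega
  have hbij : Function.Bijective f :=
    hf.bijective_of_nat_card_le (by rw [Nat.card_zmod, ← Subgroup.index_eq_card, hidx])
  -- ### `b = s^i · b'` with `b' ∈ Π^tp_{X̲̲} ∩ Δ^tp_Y`
  obtain ⟨i, hi⟩ := hbij.2 (QuotientGroup.mk ⟨b, hb.1⟩)
  have hmemH : (s' ^ i.val)⁻¹ * ⟨b, hb.1⟩ ∈ H := QuotientGroup.eq.1 hi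
  rw [hH, Subgroup.mem_subgroupOf] at hmemH
  have hval : (((s' ^ i.val)⁻¹ * ⟨b, hb.1⟩ : ↥D.GtpY) : D.PiTemp) = (s ^ i.val)⁻¹ * b := by
    rw [Subgroup.coe_mul, Subgroup.coe_inv, SubgroupClass.coe_pow]
  rw [hval] at hmemH
  have haugs : D.aug s = 1 := hsY.2
  refine ⟨(s ^ i.val)⁻¹ * b, ⟨hmemH.1, hmemH.2, ?_⟩, ?_⟩
  · change D.aug ((s ^ i.val)⁻¹ * b) = 1
    rw [map_mul, map_inv, map_pow, haugs, one_pow, inv_one, one_mul]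
    exact hb.2
  · have hsell : D.thetaToEll (D.toTheta s) = 1 := by rw [hst]; exact htΘ
    rw [map_mul, map_inv, map_pow, map_mul, map_inv, map_pow, hsell, one_pow, inv_one, one_mul]

end Literature.IUT.HodgeArakelov

end
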